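import Literature.NumberTheory.LFunctions.Zhang2022.KnifeEdgeOffDiagForm
import Literature.NumberTheory.LFunctions.Zhang2022.KnifeEdgeWallCross

/-!
# Zhang (2022), rung F-S3 (Landau–Siegel programme; §D edge len, families B-len / B-multi): the SLOT CALCULUS of the
# discrete mean — scaling of the polar pairing, the bulk ⊕ overhang split of a two-piece design at the wall, the slot
# SHAPES (in-class · cross · overhang / band) and the PROVED compositions into the rows of record
# `KnifeEdge.EStarLenPlusShape` (E-002, p458017) and `KnifeEdge.EMultiBand` (E-034, p458037)

Y. Zhang, *Discrete mean estimates and the Landau–Siegel zero*, arXiv:2211.02515v1 [Zhang2022LandauSiegel] — an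
unrefereed manuscript under adjudication. **WHAT THIS IS NOT: not a claim about Theorems 1–2 of arXiv:2211.02515, about
Landau–Siegel zeros, or about Parity. The programme SEARCHES and TYPES; no claim about Landau–Siegel zeros, Theorems 1–2
of arXiv:2211.02515 or a repaired Margin232 until a kernel theorem says so. Nothing here asserts any estimate:
`InClassMean`, `CrossMean`, `OverhangMean`, `BandMean` are bare `Prop`s (statement SHAPES of (A)-conditional
asymptotics, one per block of the completed quadratic form); every `theorem` is exact finite algebra of Zhang's discrete
mean or an implication between shapes.**

WHY. The discrete mean of a composite design is the sum of its blocks EXACTLY — two-piece design `s·u ⊕ v` (`u` in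
class, `n ≤ P`; `v` beyond the wall, `⌈P⌉ ≤ n < ⌈P^θ⌉`): `Ξ(s·H_u + B_v) = |s|²Ξ(H_u) + Ξ(B_v) + 2Re(s·Ξ(H_u,B_v))`
(`discMean_add` of `KnifeEdgeWallCross` + `discMean_smul`, `discPolar_smul_left`, `profPoly_twoPiece` here); wall design:
`discMean_wallDesign`. Hence the rows stating the asymptotic of a WHOLE design — E-002 `EStarLenPlusShape c' θ X 𝒱`
(constant `|s|²𝔅(u) + 2Re(s·crossCoeff) + overhangConst`) and E-034 `EMultiBand c' K Λ X` (constant `𝔅(u) + 2Re X(u,W)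
+ |h⁺|²K[b]`) — follow from THREE slot statements, one per block: the in-class slot `InClassMean` (Zhang's Prop 7.1 /
(8.23) dictionary for one piece of length `P`), the CROSS slot (`CrossMean θ X 𝒱`; for wall designs
`ECrossBandAsymp Λ X` of `KnifeEdgeWallCross` — E-006 / E-002's off-diagonal content) and the diagonal slot beyond the
wall (`OverhangMean θ X 𝒱`; `BandMean K Λ` — E-005/E-034's diagonal content): `eStarLenPlusShape_of_slots`,
`eMultiBand_of_slots` (proved). A len card's «First lemma» on the CROSS term alone thus has a typed home composing into
the row of record; Part 5 reads the decided world `X = invisibleForm θ` (E-003) as «cross and overhang slots are o(𝔞𝔓)».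

## References
* Y. Zhang, arXiv:2211.02515v1 (2022), §2 (2.16)–(2.20), (2.23)–(2.30); §7 Prop 7.1 (7.2); §8 (8.3)–(8.5), (8.23).
  [cite: Zhang2022LandauSiegel, §2, §7, §8]
-/

noncomputable section

open Complex Real ComplexConjugate Set
open _root_.MeasureTheory

namespace Literature.NumberTheory.LFunctions.Zhang2022

namespace KnifeEdge

open Repair Skeleton

/-! ### Part 1 — scaling algebra of the discrete mean and its polar pairing (exact, every modulus) -/

section Algebra

variable {c' : ℝ} {D : ℕ} {χ : DirichletCharacter ℂ D}

/-- `Ξ(a·F) = |a|²·Ξ(F)`. [cite: Zhang2022LandauSiegel, §2 (2.16)–(2.20)] -/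
theorem discMean_smul (a : ℂ) (F : Chr D → ℂ → ℂ) : discMean c' χ (a • F) = ‖a‖ ^ 2 * discMean c' χ F := by
  unfold discMean
  simp only [Pi.smul_apply, smul_eq_mul]
  rw [Finset.mul_sum]
  refine Finset.sum_congr rfl fun i _ => ?_
  rw [norm_mul, mul_pow]
  ring

/-- `Ξ(a·F, G) = a·Ξ(F,G)`. [cite: Zhang2022LandauSiegel, §2 (2.17)] -/
theorem discPolar_smul_left (a : ℂ) (F G : Chr D → ℂ → ℂ) :
    discPolar c' χ (a • F) G = a * discPolar c' χ F G := by
  unfold discPolar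
  simp only [Pi.smul_apply, smul_eq_mul]
  rw [Finset.mul_sum]
  refine Finset.sum_congr rfl fun i _ => ?_
  ring

/-- `Ξ(F, a·G) = ā·Ξ(F,G)`. [cite: Zhang2022LandauSiegel, §2 (2.17)] -/
theorem discPolar_smul_right (a : ℂ) (F G : Chr D → ℂ → ℂ) :
    discPolar c' χ F (a • G) = conj a * discPolar c' χ F G := by
  unfold discPolar
  simp only [Pi.smul_apply, smul_eq_mul]
  rw [Finset.mul_sum]
  refine Finset.sum_congr rfl fun i _ => ?_
  rw [map_mul]
  ring

end Algebra

/-! ### Part 2 — blocks of a profile polynomial and the two-piece split at the wall (pointwise identities) -/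

section Splits

variable {D : ℕ} (χ : DirichletCharacter ℂ D)

/-- The block `Σ_{M ≤ n < N} χψ(n)·𝔤(log n/log P)·n^{−s}` of a profile polynomial between two lengths (the piece of
`KnifeEdge.profPoly` from `M` on; `M = ⌈P⌉` is the wall for an overhang piece). [cite: Zhang2022LandauSiegel, §2 (2.23), (2.30)] -/
def blockPoly (x : Chr D) (M N : ℕ) (𝔤 : ℝ → ℂ) (s : ℂ) : ℂ :=
  ∑ n ∈ Finset.Ico M N, pc χ x n * 𝔤 (Real.log n / Real.log (bigP D)) * (n : ℂ) ^ (-s)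

/-- A profile polynomial splits at any intermediate length into a shorter one plus a block. [cite: Zhang2022LandauSiegel, §2 (2.23), (2.30)] -/
theorem profPoly_eq_add_blockPoly (x : Chr D) {M N : ℕ} (hM : 1 ≤ M) (hMN : M ≤ N) (𝔤 : ℝ → ℂ) (s : ℂ) :
    profPoly χ x 𝔤 N s = profPoly χ x 𝔤 M s + blockPoly χ x M N 𝔤 s := by
  unfold profPoly blockPoly
  rw [← Finset.sum_Ico_consecutive _ hM hMN]

/-- Profile polynomials of profiles agreeing at the samples `1 ≤ n < N` coincide. [cite: Zhang2022LandauSiegel, §2 (2.23)] -/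
theorem profPoly_congr {𝔤₁ 𝔤₂ : ℝ → ℂ} {N : ℕ} (x : Chr D) (s : ℂ)
    (h : ∀ n : ℕ, 1 ≤ n → n < N → 𝔤₁ (Real.log n / Real.log (bigP D)) = 𝔤₂ (Real.log n / Real.log (bigP D))) :
    profPoly χ x 𝔤₁ N s = profPoly χ x 𝔤₂ N s := by
  unfold profPoly
  refine Finset.sum_congr rfl fun n hn => ?_
  rw [Finset.mem_Ico] at hn
  rw [h n hn.1 hn.2]

/-- Blocks of profiles agreeing at the samples `M ≤ n < N` coincide. [cite: Zhang2022LandauSiegel, §2 (2.23), (2.30)] -/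
theorem blockPoly_congr {𝔤₁ 𝔤₂ : ℝ → ℂ} {M N : ℕ} (x : Chr D) (s : ℂ)
    (h : ∀ n : ℕ, M ≤ n → n < N → 𝔤₁ (Real.log n / Real.log (bigP D)) = 𝔤₂ (Real.log n / Real.log (bigP D))) :
    blockPoly χ x M N 𝔤₁ s = blockPoly χ x M N 𝔤₂ s := by
  unfold blockPoly
  refine Finset.sum_congr rfl fun n hn => ?_
  rw [Finset.mem_Ico] at hn
  rw [h n hn.1 hn.2]

/-- Below `⌈P⌉` the logarithmic position `log n/log P` is `< 1`. [cite: Zhang2022LandauSiegel, §2 (2.23), §7 (7.2)] -/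
theorem logRatio_lt_one_of_lt_ceil (hP : 1 < bigP D) {n : ℕ} (h1 : 1 ≤ n) (hn : n < ⌈bigP D⌉₊) :
    Real.log n / Real.log (bigP D) < 1 := by
  have hn0 : (0 : ℝ) < n := by exact_mod_cast h1
  exact (div_lt_one (Real.log_pos hP)).mpr (Real.log_lt_log hn0 (Nat.lt_ceil.mp hn))

/-- From `⌈P⌉` on the logarithmic position is `≥ 1`. [cite: Zhang2022LandauSiegel, §2 (2.23), §7 (7.2)] -/
theorem one_le_logRatio_of_ceil_le (hP : 1 < bigP D) {n : ℕ} (hn : ⌈bigP D⌉₊ ≤ n) :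
    1 ≤ Real.log n / Real.log (bigP D) :=
  (one_le_div (Real.log_pos hP)).mpr (Real.log_le_log (by linarith) (Nat.ceil_le.mp hn))

/-- Up to `⌊P⌋` the logarithmic position is `≤ 1`. [cite: Zhang2022LandauSiegel, §2 (2.23), §7 (7.2)] -/
theorem logRatio_le_one_of_le_floor (hP : 1 < bigP D) {n : ℕ} (h1 : 1 ≤ n) (hn : n ≤ ⌊bigP D⌋₊) :
    Real.log n / Real.log (bigP D) ≤ 1 := by
  have hn0 : (0 : ℝ) < n := by exact_mod_cast h1
  exact (div_le_one (Real.log_pos hP)).mpr (Real.log_le_log hn0 ((Nat.le_floor_iff (by linarith)).mp hn))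

/-- Beyond `⌊P⌋` the logarithmic position is `> 1`. [cite: Zhang2022LandauSiegel, §2 (2.23), §7 (7.2)] -/
theorem one_lt_logRatio_of_floor_lt (hP : 1 < bigP D) {n : ℕ} (hn : ⌊bigP D⌋₊ < n) :
    1 < Real.log n / Real.log (bigP D) :=
  (one_lt_div (Real.log_pos hP)).mpr (Real.log_lt_log (by linarith) ((Nat.floor_lt (by linarith)).mp hn))

/-- `1 ≤ ⌈P⌉` once `P > 1`. [cite: Zhang2022LandauSiegel, §2 (2.6)] -/
theorem one_le_ceil_bigP (hP : 1 < bigP D) : 1 ≤ ⌈bigP D⌉₊ :=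
  Nat.one_le_iff_ne_zero.mpr (Nat.pos_iff_ne_zero.mp (Nat.ceil_pos.mpr (by linarith)))

/-- **The two-piece split.** For `u` vanishing on `[1,∞)` and `v` vanishing below `1`, the profile polynomial of
`s·u + v` of any length `N ≥ ⌈P⌉` is `s·(polynomial of u of length ⌈P⌉) + (block of v from ⌈P⌉ to N)`, pointwise in
`(ψ, s)`; the sample `n = P` (if `P ∈ ℕ`) belongs to the overhang. [cite: Zhang2022LandauSiegel, §7 (7.2), §2 (2.30)] -/
theorem profPoly_twoPiece (hP : 1 < bigP D) {u v : ℝ → ℂ} (hu : ∀ y, 1 ≤ y → u y = 0)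
    (hv : ∀ y, y < 1 → v y = 0) (s : ℂ) {N : ℕ} (hN : ⌈bigP D⌉₊ ≤ N) (x : Chr D) (t : ℂ) :
    profPoly χ x (fun z => s * u z + v z) N t = s * profPoly χ x u ⌈bigP D⌉₊ t + blockPoly χ x ⌈bigP D⌉₊ N v t := by
  rw [profPoly_eq_add_blockPoly χ x (one_le_ceil_bigP hP) hN]
  congr 1
  · unfold profPoly
    rw [Finset.mul_sum]
    refine Finset.sum_congr rfl fun n hn => ?_
    rw [Finset.mem_Ico] at hn
    dsimp only
    rw [hv _ (logRatio_lt_one_of_lt_ceil hP hn.1 hn.2), add_zero]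
    ring
  · refine blockPoly_congr χ x t fun n hM _ => ?_
    rw [hu _ (one_le_logRatio_of_ceil_le hP hM), mul_zero, zero_add]

/-- For a piece vanishing on `[1,∞)` the lengths `⌈P⌉` and `⌊P⌋+1` give the same polynomial (they differ at most by the
sample `n = P`, where the piece is `0`). [cite: Zhang2022LandauSiegel, §7 (7.2)] -/
theorem profPoly_ceil_eq_floor_succ (hP : 1 < bigP D) {u : ℝ → ℂ} (hu : ∀ y, 1 ≤ y → u y = 0) (x : Chr D) (t : ℂ) :
    profPoly χ x u ⌈bigP D⌉₊ t = profPoly χ x u (⌊bigP D⌋₊ + 1) t := by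
  rw [profPoly_eq_add_blockPoly χ x (one_le_ceil_bigP hP) (Nat.ceil_le_floor_add_one _)]
  suffices hb : blockPoly χ x ⌈bigP D⌉₊ (⌊bigP D⌋₊ + 1) u t = 0 by rw [hb, add_zero]
  refine Finset.sum_eq_zero fun n hn => ?_
  rw [Finset.mem_Ico] at hn
  rw [hu _ (one_le_logRatio_of_ceil_le hP hn.1), mul_zero, zero_mul]

/-- **Bridge to the wall design's bulk table:** the polynomial of `inClassExt u = u·𝟙_{z≤1}` (`KnifeEdgeWallCross`) of
any length `N ≥ ⌊P⌋+1` is the polynomial of `u` of length `⌊P⌋+1` (`1 ≤ n ≤ P`). [cite: Zhang2022LandauSiegel, §7 (7.2)] -/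
theorem profPoly_inClassExt (hP : 1 < bigP D) (u : ℝ → ℂ) {N : ℕ} (hN : ⌊bigP D⌋₊ + 1 ≤ N) (x : Chr D) (t : ℂ) :
    profPoly χ x (inClassExt u) N t = profPoly χ x u (⌊bigP D⌋₊ + 1) t := by
  rw [profPoly_eq_add_blockPoly χ x (Nat.succ_le_succ (Nat.zero_le _)) hN]
  have hb : blockPoly χ x (⌊bigP D⌋₊ + 1) N (inClassExt u) t = 0 := by
    refine Finset.sum_eq_zero fun n hn => ?_
    rw [Finset.mem_Ico] at hn
    have h1 : ¬ Real.log n / Real.log (bigP D) ≤ 1 :=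
      not_le.mpr (one_lt_logRatio_of_floor_lt hP (Nat.lt_of_succ_le hn.1))
    simp [inClassExt, h1]
  rw [hb, add_zero]
  exact profPoly_congr χ x t fun n h1 hn => by
    simp [inClassExt, logRatio_le_one_of_le_floor hP h1 (Nat.lt_succ_iff.mp hn)]

/-- Eventually (`D ≥ 3`) the mollifier length exceeds `1`: `P = exp 𝓛⁹ > 1`. [cite: Zhang2022LandauSiegel, §2 (2.6)] -/
theorem eventually_one_lt_bigP : ForAllLarge fun D _ _ => 1 < bigP D := by
  refine ForAllLarge.of_le 3 fun D _ χ hD _ _ => ?_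
  have hD' : (1 : ℝ) < D := by exact_mod_cast (by omega : 1 < D)
  have hℓ : 0 < ell D := Real.log_pos hD'
  exact Real.one_lt_exp_iff.mpr (by positivity)

/-- Eventually (`D ≥ 3`) the band is non-degenerate: `⌊P⌋ + 1 ≤ ⌈P^{1+α̃}⌉` (indeed `P < P^{1+α̃} = P·D·t₀`).
[cite: Zhang2022LandauSiegel, §2 (2.30)] -/
theorem eventually_floor_succ_le_ceil_band :
    ForAllLarge fun D _ _ => ⌊bigP D⌋₊ + 1 ≤ ⌈bigP D ^ (1 + alphaTilde D)⌉₊ := by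
  refine ForAllLarge.of_le 3 fun D _ χ hD _ _ => ?_
  have h3 : (3 : ℝ) ≤ D := by exact_mod_cast hD
  have hℓ : 1 < ell D := by
    calc (1 : ℝ) = Real.log (Real.exp 1) := (Real.log_exp 1).symm
      _ < Real.log D := Real.log_lt_log (Real.exp_pos 1)
          (by linarith [lt_trans Real.exp_one_lt_d9 (by norm_num : (2.7182818286 : ℝ) < 3)])
  have hP : 1 < bigP D := Real.one_lt_exp_iff.mpr (by positivity)
  have ht0 : 1 < t0 D := by
    calc (1 : ℝ) = 1 ^ 519 := (one_pow _).symm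
      _ < ell D ^ 519 := pow_lt_pow_left₀ hℓ zero_le_one (by norm_num)
  have hDt : 1 < (D : ℝ) * t0 D := by nlinarith
  have hα : 0 < alphaTilde D := div_pos (Real.log_pos hDt) (Real.log_pos hP)
  have hlt : bigP D < bigP D ^ (1 + alphaTilde D) := by
    calc bigP D = bigP D ^ (1 : ℝ) := (Real.rpow_one _).symm
      _ < bigP D ^ (1 + alphaTilde D) := Real.rpow_lt_rpow_of_exponent_lt hP (by linarith)
  have h1 : ⌊bigP D⌋₊ < ⌈bigP D ^ (1 + alphaTilde D)⌉₊ :=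
    Nat.lt_ceil.mpr (lt_of_le_of_lt (Nat.floor_le (by linarith)) hlt)
  omega

end Splits

/-! ### Part 3 — the three slots of a two-piece design and their composition into `EStarLenPlusShape` (E-002) -/

section TwoPieceSlots

variable (c' : ℝ)

/-- **IN-CLASS SLOT (shape, NOT asserted):** under (A), eventually in `D`, the discrete mean of the polynomial of ONE
kinked in-class profile `u` of length `P` (`1 ≤ n ≤ ⌊P⌋`) is `𝔅(u)·𝔞𝔓 + o(𝔞𝔓)` — Zhang's Prop 7.1 / (8.23) dictionary for a
single piece (for the manuscript's `H₁`: `Skeleton.Eval823`; for a general kinked piece: the dictionary of the audited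
class, a derivation). [cite: Zhang2022LandauSiegel, §7 Prop 7.1, §8 (8.23)] -/
def InClassMean : Prop :=
  ∀ (u u' : ℝ → ℂ), KinkedProfile u u' → ∀ ε : ℝ, 0 < ε → ForAllLarge fun D _ χ => AssumptionA D χ →
    |discMean c' χ (fun x t => profPoly χ x u (⌊bigP D⌋₊ + 1) t) - mainTermForm u u' * frakA χ * frakP D|
      ≤ ε * frakA χ * frakP D

/-- **CROSS SLOT of a two-piece design (shape, NOT asserted; the off-diagonal content of E-002 / E-006):** under (A),
eventually in `D`, the polar pairing of (polynomial of `u`, length `P`) and (block of `v` on `⌈P⌉ ≤ n < ⌈P^θ⌉`) is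
`crossCoeff θ X u u′ v v′·𝔞𝔓 + o(𝔞𝔓)` — tail coupling `πΦ̄_vL(u)` plus the slot `X(u,v)` — for `u` in class, `v ∈ 𝒱`.
A len card claiming a mechanism for the cross term instantiates exactly this. [cite: Zhang2022LandauSiegel, §7 (7.2), §8 (8.5), (8.11)–(8.12)] -/
def CrossMean (θ : ℝ) (X : PairFunctional) (𝒱 : (ℝ → ℂ) → (ℝ → ℂ) → Prop) : Prop :=
  ∀ (u u' v v' : ℝ → ℂ), InClassPiece u u' → 𝒱 v v' → ∀ ε : ℝ, 0 < ε →
    ForAllLarge fun D _ χ => AssumptionA D χ →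
      ‖discPolar c' χ (fun x t => profPoly χ x u (⌊bigP D⌋₊ + 1) t)
            (fun x t => blockPoly χ x ⌈bigP D⌉₊ ⌈bigP D ^ θ⌉₊ v t)
          - crossCoeff θ X u u' v v' * frakA χ * frakP D‖ ≤ ε * frakA χ * frakP D

/-- **OVERHANG SLOT (shape, NOT asserted; the diagonal content of the piece beyond the wall):** under (A), eventually in
`D`, the discrete mean of the block of `v ∈ 𝒱` on `⌈P⌉ ≤ n < ⌈P^θ⌉` is `overhangConst θ X v v′·𝔞𝔓 + o(𝔞𝔓)`
(`= (Re 𝔅_θ(v) + 2Re X(v,v))·𝔞𝔓`; band-supported `v`: the E-005/E-034 object; smooth far `v`: evaluated by the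
invisibility theorems). [cite: Zhang2022LandauSiegel, §7 (7.2), §8 (8.3)] -/
def OverhangMean (θ : ℝ) (X : PairFunctional) (𝒱 : (ℝ → ℂ) → (ℝ → ℂ) → Prop) : Prop :=
  ∀ (v v' : ℝ → ℂ), 𝒱 v v' → ∀ ε : ℝ, 0 < ε → ForAllLarge fun D _ χ => AssumptionA D χ →
    |discMean c' χ (fun x t => blockPoly χ x ⌈bigP D⌉₊ ⌈bigP D ^ θ⌉₊ v t) - overhangConst θ X v v' * frakA χ * frakP D|
      ≤ ε * frakA χ * frakP D

variable {c'}

/-- ε-bookkeeping for a design with amplitude `s`: slot errors at `δ = ε/(3(|s|+1)²)` add up to `≤ ε`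
(`(|s|² + 2|s| + 1)δ = ε/3`). [folklore] -/
private theorem twoPiece_error_bound {ε 𝔞 𝔓 A B a k : ℝ} {s C c : ℂ} (hε : 0 < ε) (h𝔞 : 0 ≤ 𝔞) (h𝔓 : 0 ≤ 𝔓)
    (h1 : |A - a * 𝔞 * 𝔓| ≤ ε / (3 * (‖s‖ + 1) ^ 2) * 𝔞 * 𝔓)
    (h2 : ‖C - c * 𝔞 * 𝔓‖ ≤ ε / (3 * (‖s‖ + 1) ^ 2) * 𝔞 * 𝔓)
    (h3 : |B - k * 𝔞 * 𝔓| ≤ ε / (3 * (‖s‖ + 1) ^ 2) * 𝔞 * 𝔓) :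
    |‖s‖ ^ 2 * A + B + 2 * (s * C).re - (a * ‖s‖ ^ 2 + 2 * (s * c).re + k) * 𝔞 * 𝔓| ≤ ε * 𝔞 * 𝔓 := by
  set δ : ℝ := ε / (3 * (‖s‖ + 1) ^ 2) with hδ
  set X : ℝ := 𝔞 * 𝔓 with hX
  have hX0 : 0 ≤ X := mul_nonneg h𝔞 h𝔓
  have hs : 0 ≤ ‖s‖ := norm_nonneg s
  have h1' : |A - a * X| ≤ δ * X := by rw [hX, ← mul_assoc, ← mul_assoc]; exact h1
  have h3' : |B - k * X| ≤ δ * X := by rw [hX, ← mul_assoc, ← mul_assoc]; exact h3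
  have h2X : ‖C - c * (X : ℂ)‖ ≤ δ * X := by
    rw [show c * (X : ℂ) = c * 𝔞 * 𝔓 by rw [hX]; push_cast; ring, hX, ← mul_assoc]; exact h2
  have hre : (s * (C - c * (X : ℂ))).re = (s * C).re - (s * c).re * X := by
    rw [mul_sub, Complex.sub_re, ← mul_assoc, Complex.re_mul_ofReal]
  have h2' : |(s * C).re - (s * c).re * X| ≤ ‖s‖ * (δ * X) := by
    rw [← hre]
    calc |(s * (C - c * (X : ℂ))).re| ≤ ‖s * (C - c * (X : ℂ))‖ := Complex.abs_re_le_norm _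
      _ = ‖s‖ * ‖C - c * (X : ℂ)‖ := norm_mul _ _
      _ ≤ ‖s‖ * (δ * X) := mul_le_mul_of_nonneg_left h2X hs
  have key : ‖s‖ ^ 2 * A + B + 2 * (s * C).re - (a * ‖s‖ ^ 2 + 2 * (s * c).re + k) * 𝔞 * 𝔓
      = ‖s‖ ^ 2 * (A - a * X) + 2 * ((s * C).re - (s * c).re * X) + (B - k * X) := by
    rw [hX]; ring
  rw [key]
  have hA : |‖s‖ ^ 2 * (A - a * X)| ≤ ‖s‖ ^ 2 * (δ * X) := by
    rw [abs_mul, abs_of_nonneg (by positivity : (0:ℝ) ≤ ‖s‖ ^ 2)]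
    exact mul_le_mul_of_nonneg_left h1' (by positivity)
  have hB : |2 * ((s * C).re - (s * c).re * X)| ≤ 2 * (‖s‖ * (δ * X)) := by
    rw [abs_mul, abs_two]; exact mul_le_mul_of_nonneg_left h2' (by norm_num)
  have hsum : (‖s‖ ^ 2 + 2 * ‖s‖ + 1) * δ = ε / 3 := by
    have h0 : (‖s‖ + 1) ^ 2 ≠ 0 := by positivity
    rw [hδ]; field_simp; ring
  calc |‖s‖ ^ 2 * (A - a * X) + 2 * ((s * C).re - (s * c).re * X) + (B - k * X)|
      ≤ |‖s‖ ^ 2 * (A - a * X)| + |2 * ((s * C).re - (s * c).re * X)| + |B - k * X| := abs_add_three _ _ _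
    _ ≤ ‖s‖ ^ 2 * (δ * X) + 2 * (‖s‖ * (δ * X)) + δ * X := by linarith
    _ = (‖s‖ ^ 2 + 2 * ‖s‖ + 1) * δ * X := by ring
    _ = ε / 3 * X := by rw [hsum]
    _ ≤ ε * X := by nlinarith
    _ = ε * 𝔞 * 𝔓 := by rw [hX, mul_assoc]

/-- **COMPOSITION (proved): the three slots give E-002's row.** If the in-class slot, the cross slot for `(X, 𝒱)` and
the overhang slot for `(X, 𝒱)` hold and the pieces of `𝒱` vanish below the wall, then `EStarLenPlusShape c' θ X 𝒱`
(p458017) holds for every `θ ≥ 1`: the discrete mean of `s·u ⊕ v` is the sum of its blocks EXACTLY (`profPoly_twoPiece`,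
`discMean_add`, `discMean_smul`, `discPolar_smul_left`) and `twoPieceMainTerm = |s|²𝔅(u) + 2Re(s·crossCoeff) +
overhangConst` (`twoPieceMainTerm_eq`). All three slots are OPEN (A)-conditional statements; nothing asserted.
[cite: Zhang2022LandauSiegel, §7 Prop 7.1 (7.2), §8 (8.3)–(8.5), (8.23)] -/
theorem eStarLenPlusShape_of_slots {θ : ℝ} (hθ : 1 ≤ θ) {X : PairFunctional}
    {𝒱 : (ℝ → ℂ) → (ℝ → ℂ) → Prop} (h𝒱 : ∀ v v', 𝒱 v v' → ∀ y, y < 1 → v y = 0)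
    (hB : InClassMean c') (hC : CrossMean c' θ X 𝒱) (hO : OverhangMean c' θ X 𝒱) :
    EStarLenPlusShape c' θ X 𝒱 := by
  intro u u' v v' s hu hv ε hε
  have hδ : 0 < ε / (3 * (‖s‖ + 1) ^ 2) := by positivity
  have hev := (((hB u u' hu.kinked _ hδ).and (hC u u' v v' hu hv _ hδ)).and (hO v v' hv _ hδ)).and
    eventually_one_lt_bigP
  refine hev.mono fun D _ χ _ _ h hA => ?_
  obtain ⟨⟨⟨h1, h2⟩, h3⟩, hP⟩ := h
  have hN : ⌈bigP D⌉₊ ≤ ⌈bigP D ^ θ⌉₊ := Nat.ceil_le_ceil (Real.self_le_rpow_of_one_le hP.le hθ)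
  set F : Chr D → ℂ → ℂ := fun x t => profPoly χ x u (⌊bigP D⌋₊ + 1) t with hF
  set G : Chr D → ℂ → ℂ := fun x t => blockPoly χ x ⌈bigP D⌉₊ ⌈bigP D ^ θ⌉₊ v t with hG
  have hsplit : (fun x t => profPoly χ x (fun z => s * u z + v z) ⌈bigP D ^ θ⌉₊ t) = fun x t => (s • F) x t + G x t := by
    funext x t; simp only [Pi.smul_apply, smul_eq_mul, hF, hG]
    rw [profPoly_twoPiece χ hP hu.vanish (h𝒱 v v' hv) s hN, profPoly_ceil_eq_floor_succ χ hP hu.vanish]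
  rw [hsplit, discMean_add (s • F) G, discMean_smul, discPolar_smul_left, twoPieceMainTerm_eq]
  exact twoPiece_error_bound hε (frakA_nonneg χ) (frakP_nonneg D) (h1 hA) (h2 hA) (h3 hA)

end TwoPieceSlots

/-! ### Part 4 — the band diagonal slot of a wall design and the composition into `EMultiBand` (E-034) -/

section WallSlots

variable (c' : ℝ)

/-- **BAND DIAGONAL SLOT (shape, NOT asserted; the diagonal content of E-005/E-034 at the discrete level):** under (A),
eventually in `D`, the discrete mean of the band table of a wall design (`KnifeEdgeWallCross.wallBandPoly`, balanced
amplitude `Λ(D,χ)^{−1/2}`) is `|h⁺|²·K[b]·𝔞𝔓 + o(𝔞𝔓)`. [cite: Zhang2022LandauSiegel, §2 (2.30), §8 (8.3), Lemma 8.1] -/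
def BandMean (K : (ℝ → ℂ) → ℝ) (Λ : BandScale) : Prop :=
  ∀ (W : WallData) (ε : ℝ), 0 < ε → ForAllLarge fun D _ χ => AssumptionA D χ →
    |discMean c' χ (wallBandPoly χ Λ W) - ‖W.hPlus‖ ^ 2 * K W.band * frakA χ * frakP D| ≤ ε * frakA χ * frakP D

variable {c'}

/-- **COMPOSITION (proved): in-class slot + E-006's cross asymptotic + band diagonal slot give E-034's row.** If
`InClassMean c'`, `ECrossBandAsymp c' Λ X` (p459102) and `BandMean c' K Λ` hold, then `EMultiBand c' K Λ X` (p458037):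
the discrete mean of the wall design is bulk + band + 2Re cross EXACTLY (`discMean_wallDesign`), the bulk table is the
length-`P` polynomial of `u` (`profPoly_inClassExt`), and `wallMainTerm = 𝔅(u) + 2Re X(u,W) + |h⁺|²K[b]`. All three
hypotheses are OPEN (A)-conditional statements; nothing asserted. [cite: Zhang2022LandauSiegel, §7 (7.2), §8 (8.3)–(8.5), Lemma 8.1] -/
theorem eMultiBand_of_slots {K : (ℝ → ℂ) → ℝ} {Λ : BandScale} {X : WallCross}
    (hB : InClassMean c') (hC : ECrossBandAsymp c' Λ X) (hD : BandMean c' K Λ) : EMultiBand c' K Λ X := by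
  intro u u' hu W ε hε
  have hδ : 0 < ε / (3 * (‖(1 : ℂ)‖ + 1) ^ 2) := by positivity
  have hev := (((hB u u' hu _ hδ).and (hC u u' hu W _ hδ)).and (hD W _ hδ)).and
    (eventually_one_lt_bigP.and eventually_floor_succ_le_ceil_band)
  refine hev.mono fun D _ χ _ _ h hA => ?_
  obtain ⟨⟨⟨h1, h2⟩, h3⟩, hP, hN⟩ := h
  have hbulk : wallBulkPoly χ u = fun x t => profPoly χ x u (⌊bigP D⌋₊ + 1) t :=
    funext fun x => funext fun t => profPoly_inClassExt χ hP u hN x t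
  rw [discMean_wallDesign, wallMainTerm]
  rw [hbulk] at h2 ⊢
  -- the wall design is the two-piece bookkeeping at amplitude `s = 1`
  have key := twoPiece_error_bound (s := 1) hε (frakA_nonneg χ) (frakP_nonneg D) (h1 hA) (h2 hA) (h3 hA)
  simpa only [norm_one, one_pow, one_mul, mul_one] using key

end WallSlots

/-! ### Part 5 — the decided world `X = invisibleForm θ` as an instance of the slots (proved) -/

section Readings

variable {c' : ℝ}

/-- **In the decided world `X = invisibleForm θ` the cross slot on the smooth class says exactly «the bulk × overhang
polar pairing is `o(𝔞𝔓)`»** (`crossCoeff θ (invisibleForm θ) = 0` on `InClassPiece × OverhangPiece θ`,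
`crossCoeff_invisibleForm`) — registry E-003/E-006's «cross term invisible» as an instance of `CrossMean`.
[cite: Zhang2022LandauSiegel, §7 Prop 7.1 (7.2), §8 (8.11)–(8.12)] -/
theorem crossMean_invisibleForm_iff {θ : ℝ} (hθ : 1 ≤ θ) :
    CrossMean c' θ (invisibleForm θ) (OverhangPiece θ) ↔
      ∀ (u u' v v' : ℝ → ℂ), InClassPiece u u' → OverhangPiece θ v v' → ∀ ε : ℝ, 0 < ε →
        ForAllLarge fun D _ χ => AssumptionA D χ →
          ‖discPolar c' χ (fun x t => profPoly χ x u (⌊bigP D⌋₊ + 1) t)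
              (fun x t => blockPoly χ x ⌈bigP D⌉₊ ⌈bigP D ^ θ⌉₊ v t)‖ ≤ ε * frakA χ * frakP D := by
  unfold CrossMean
  refine forall₄_congr fun u u' v v' => forall_congr' fun hu => forall_congr' fun hv => ?_
  rw [(crossCoeff_invisibleForm hθ hu hv).1]
  simp only [zero_mul, sub_zero]

/-- **The overhang slot in the decided world** says «the overhang block's mean is `o(𝔞𝔓)`»
(`overhangConst θ (invisibleForm θ) = 0` on `OverhangPiece θ`). [cite: Zhang2022LandauSiegel, §7 (7.2), §8 (8.3)] -/
theorem overhangMean_invisibleForm_iff {θ : ℝ} (hθ : 1 ≤ θ) :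
    OverhangMean c' θ (invisibleForm θ) (OverhangPiece θ) ↔
      ∀ (v v' : ℝ → ℂ), OverhangPiece θ v v' → ∀ ε : ℝ, 0 < ε → ForAllLarge fun D _ χ => AssumptionA D χ →
        |discMean c' χ (fun x t => blockPoly χ x ⌈bigP D⌉₊ ⌈bigP D ^ θ⌉₊ v t)| ≤ ε * frakA χ * frakP D := by
  unfold OverhangMean
  refine forall₂_congr fun v v' => forall_congr' fun hv => ?_
  rw [(crossCoeff_invisibleForm hθ inClassPiece_gStar hv).2]
  simp only [zero_mul, sub_zero]

end Readings

end KnifeEdge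

end Literature.NumberTheory.LFunctions.Zhang2022

end
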